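import Mathlib
import HarnessLib
import Literature.Analysis.FluidPDE.TypeIAncientMildClassical

/-!
# Crux `FarPastLedger` (stmt-NavierStokesRegularity-14060), line `uloc-gronwall-transplant`: the doubling Grönwall closure

Composition file of the lead's skeleton: from the linear flux ledger (stub LFL, as a hypothesis
with the near/far pressure predicate `NF` abstract) and the pressure block (a classical pressure
with `NF` on every window, hypothesis), the unit-window ledger
`∀ C ∃ K ∀ u ∈ A_C ∀ t ∈ (−1,0), ∫_{B₁(0)}|u(t)|² ≤ K` by a DOUBLING Grönwall over a uniform
partition of `[−1, t]` into `n = ⌈4N + 16N²C² + 1⌉` steps (no measurability, no exponent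
bootstrap): on each step the sup of the unit-ball energies is absorbed (`doubling_step`), giving
`K(C) = (2N+1)ⁿ C² |B₁|` (`unitWindow_of_ledger`, registered sub-goal `fpl_closure_main`).
-/

noncomputable section

open MeasureTheory Set Filter Metric Topology
open Literature.Analysis.FluidPDE Literature.Analysis.UnboundedOperators

set_option linter.dupNamespace false -- nested layout Summit.<S>.<Sub>, Sub = S (D-0017)

namespace Summit.NavierStokesRegularity.NavierStokesRegularity.Theorems

/-- Type-I bound on unit balls: `∫_{B₁(z)} ‖u(τ)‖² ≤ C²/(−τ) · |B₁|`. -/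
theorem energy_unitBall_le_typeI {C : ℝ} {u : ℝ → (EuclideanSpace ℝ (Fin 3)) → (EuclideanSpace ℝ (Fin 3))} (hu : IsTypeIAncientMild C u) {τ : ℝ}
    (hτ : τ < 0) (z : (EuclideanSpace ℝ (Fin 3))) :
    ∫ x in ball z 1, ‖u τ x‖ ^ 2 ≤ C ^ 2 / (-τ) * (volume (ball (0 : (EuclideanSpace ℝ (Fin 3))) 1)).toReal := by
  have hpt : ∀ x, ‖u τ x‖ ^ 2 ≤ C ^ 2 / (-τ) := fun x => by
    have h1 := hu.norm_le hτ x
    have h2 : (C / Real.sqrt (-τ)) ^ 2 = C ^ 2 / (-τ) := by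
      rw [div_pow, Real.sq_sqrt (by linarith)]
    rw [← h2]
    exact pow_le_pow_left₀ (norm_nonneg _) h1 2
  calc ∫ x in ball z 1, ‖u τ x‖ ^ 2 ≤ ∫ _x in ball z 1, C ^ 2 / (-τ) :=
        integral_mono_of_nonneg (Eventually.of_forall fun x => by positivity)
          (integrableOn_const measure_ball_lt_top.ne) (Eventually.of_forall hpt)
    _ = C ^ 2 / (-τ) * (volume (ball (0 : (EuclideanSpace ℝ (Fin 3))) 1)).toReal := by
        rw [setIntegral_const, smul_eq_mul, measureReal_def, mul_comm,
          Measure.addHaar_ball_center volume z 1]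

/-- `√x − √y ≤ √(x − y)` for `0 ≤ y ≤ x`. -/
theorem sqrt_sub_sqrt_le {x y : ℝ} (hy : 0 ≤ y) (hxy : y ≤ x) :
    Real.sqrt x - Real.sqrt y ≤ Real.sqrt (x - y) := by
  rw [sub_le_iff_le_add]
  have hx : 0 ≤ x := hy.trans hxy
  have h1 : 0 ≤ Real.sqrt (x - y) := Real.sqrt_nonneg _
  have h2 : 0 ≤ Real.sqrt y := Real.sqrt_nonneg _
  rw [Real.sqrt_le_left (by positivity)]
  nlinarith [Real.sq_sqrt (sub_nonneg.2 hxy), Real.sq_sqrt hy, mul_nonneg h1 h2]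

/-- Absorption: if every element of a nonempty bounded set is `≤ A + sup/2` then `sup ≤ 2A`. -/
theorem csSup_le_two_mul {T : Set ℝ} (hne : T.Nonempty) {A : ℝ}
    (h : ∀ x ∈ T, x ≤ A + sSup T / 2) : sSup T ≤ 2 * A := by
  have := csSup_le hne h
  linarith

/-- ONE DOUBLING STEP. On a window time interval `[a, b] ⊂ (−2, 0)` on which the ledger
coefficient satisfies `N((b−a) + C(√(−a) − √(−b))) ≤ 1/2`, a bound `F` for the unit-ball energies
at time `a` propagates as `2NF` to all of `[a, b]` (sup over the interval absorbed). -/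
theorem doubling_step {C N : ℝ} (hN : 0 ≤ N) (hC : 0 ≤ C) {u : ℝ → (EuclideanSpace ℝ (Fin 3)) → (EuclideanSpace ℝ (Fin 3))}
    (hLu : ∀ (s' t' : ℝ), -2 < s' → s' ≤ t' → t' < 0 → ∀ (F₀ B : ℝ), 0 ≤ B →
      (∀ z : (EuclideanSpace ℝ (Fin 3)), ∫ x in ball z 1, ‖u s' x‖ ^ 2 ≤ F₀) →
      (∀ τ ∈ Icc s' t', ∀ z : (EuclideanSpace ℝ (Fin 3)), ∫ x in ball z 1, ‖u τ x‖ ^ 2 ≤ B) →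
      ∀ x₀ : (EuclideanSpace ℝ (Fin 3)), ∫ x in ball x₀ 1, ‖u t' x‖ ^ 2 ≤
        N * F₀ + N * B * ((t' - s') + C * (Real.sqrt (-s') - Real.sqrt (-t'))))
    {a b : ℝ} (hab : a ≤ b) (ha : -2 < a) (hb : b < 0)
    (hμ : N * ((b - a) + C * (Real.sqrt (-a) - Real.sqrt (-b))) ≤ 1 / 2)
    {B₀ : ℝ} (hB₀ : ∀ τ ∈ Icc a b, ∀ z : (EuclideanSpace ℝ (Fin 3)), ∫ x in ball z 1, ‖u τ x‖ ^ 2 ≤ B₀)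
    {F : ℝ} (hF : ∀ z : (EuclideanSpace ℝ (Fin 3)), ∫ x in ball z 1, ‖u a x‖ ^ 2 ≤ F) :
    ∀ τ ∈ Icc a b, ∀ z : (EuclideanSpace ℝ (Fin 3)), ∫ x in ball z 1, ‖u τ x‖ ^ 2 ≤ 2 * N * F := by
  set E : ℝ → (EuclideanSpace ℝ (Fin 3)) → ℝ := fun τ z => ∫ x in ball z 1, ‖u τ x‖ ^ 2 with hE
  set T : Set ℝ := (fun q : ℝ × (EuclideanSpace ℝ (Fin 3)) => E q.1 q.2) '' (Icc a b ×ˢ univ) with hT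
  have hne : T.Nonempty := ⟨E a 0, ⟨(a, 0), ⟨⟨le_rfl, hab⟩, mem_univ _⟩, rfl⟩⟩
  have hbdd : BddAbove T := by
    refine ⟨B₀, ?_⟩
    rintro _ ⟨⟨τ, z⟩, ⟨hτ, -⟩, rfl⟩
    exact hB₀ τ hτ z
  have hmem : ∀ τ ∈ Icc a b, ∀ z : (EuclideanSpace ℝ (Fin 3)), E τ z ∈ T := fun τ hτ z => ⟨(τ, z), ⟨hτ, mem_univ _⟩, rfl⟩
  have hle : ∀ τ ∈ Icc a b, ∀ z : (EuclideanSpace ℝ (Fin 3)), E τ z ≤ sSup T := fun τ hτ z => le_csSup hbdd (hmem τ hτ z)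
  have hS0 : 0 ≤ sSup T := by
    refine le_trans ?_ (hle a ⟨le_rfl, hab⟩ 0)
    exact integral_nonneg fun x => by positivity
  -- every energy on the interval is `≤ N F + sup/2`
  have key : ∀ x ∈ T, x ≤ N * F + sSup T / 2 := by
    rintro _ ⟨⟨τ, z⟩, ⟨hτ, -⟩, rfl⟩
    have hτ0 : τ < 0 := lt_of_le_of_lt hτ.2 hb
    have h1 := hLu a τ ha hτ.1 hτ0 F (sSup T) hS0 hF
      (fun τ' hτ' z' => hle τ' ⟨hτ'.1, hτ'.2.trans hτ.2⟩ z') z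
    have hcoef : (τ - a) + C * (Real.sqrt (-a) - Real.sqrt (-τ)) ≤
        (b - a) + C * (Real.sqrt (-a) - Real.sqrt (-b)) := by
      have : Real.sqrt (-b) ≤ Real.sqrt (-τ) := Real.sqrt_le_sqrt (by linarith [hτ.2])
      nlinarith [hτ.2]
    have h2 : N * sSup T * ((τ - a) + C * (Real.sqrt (-a) - Real.sqrt (-τ))) ≤ sSup T / 2 := by
      calc N * sSup T * ((τ - a) + C * (Real.sqrt (-a) - Real.sqrt (-τ)))
          ≤ N * sSup T * ((b - a) + C * (Real.sqrt (-a) - Real.sqrt (-b))) :=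
            mul_le_mul_of_nonneg_left hcoef (mul_nonneg hN hS0)
        _ = sSup T * (N * ((b - a) + C * (Real.sqrt (-a) - Real.sqrt (-b)))) := by ring
        _ ≤ sSup T * (1 / 2) := mul_le_mul_of_nonneg_left hμ hS0
        _ = sSup T / 2 := by ring
    show E τ z ≤ N * F + sSup T / 2
    exact h1.trans (by linarith)
  have hsup : sSup T ≤ 2 * (N * F) := csSup_le_two_mul hne key
  intro τ hτ z
  exact (hle τ hτ z).trans (by linarith)

/-- From LFL (with COV, SHELL discharged) and the pressure block: the unit-window ledger. -/
theorem unitWindow_of_ledger {NF : ℝ → ℝ → (ℝ → (EuclideanSpace ℝ (Fin 3)) → (EuclideanSpace ℝ (Fin 3))) → (ℝ → (EuclideanSpace ℝ (Fin 3)) → ℝ) → ℝ → Prop}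
    {c₀ N : ℝ} (hN : 0 ≤ N)
    (hNF : ∀ (C : ℝ) (u : ℝ → (EuclideanSpace ℝ (Fin 3)) → (EuclideanSpace ℝ (Fin 3))), IsTypeIAncientMild C u → ∀ t₀ < (0 : ℝ),
      ∃ p : ℝ → (EuclideanSpace ℝ (Fin 3)) → ℝ, IsClassicalNSSolutionOn (Ioo t₀ 0) 1 0 u p ∧ NF c₀ C u p t₀)
    (hL : ∀ (C : ℝ) (u : ℝ → (EuclideanSpace ℝ (Fin 3)) → (EuclideanSpace ℝ (Fin 3))), IsTypeIAncientMild C u → ∀ (t₀ : ℝ) (p : ℝ → (EuclideanSpace ℝ (Fin 3)) → ℝ),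
      IsClassicalNSSolutionOn (Ioo t₀ 0) 1 0 u p → NF c₀ C u p t₀ →
      ∀ (s' t' : ℝ), t₀ < s' → s' ≤ t' → t' < 0 → ∀ (F₀ B : ℝ), 0 ≤ B →
      (∀ z : (EuclideanSpace ℝ (Fin 3)), ∫ x in ball z 1, ‖u s' x‖ ^ 2 ≤ F₀) →
      (∀ τ ∈ Icc s' t', ∀ z : (EuclideanSpace ℝ (Fin 3)), ∫ x in ball z 1, ‖u τ x‖ ^ 2 ≤ B) →
      ∀ x₀ : (EuclideanSpace ℝ (Fin 3)), ∫ x in ball x₀ 1, ‖u t' x‖ ^ 2 ≤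
        N * F₀ + N * B * ((t' - s') + C * (Real.sqrt (-s') - Real.sqrt (-t')))) :
    ∀ C : ℝ, ∃ K : ℝ, ∀ (u : ℝ → (EuclideanSpace ℝ (Fin 3)) → (EuclideanSpace ℝ (Fin 3))), IsTypeIAncientMild C u → ∀ t ∈ Ioo (-1 : ℝ) 0,
      ∫ x in ball (0 : (EuclideanSpace ℝ (Fin 3))) 1, ‖u t x‖ ^ 2 ≤ K := by
  intro C
  set V : ℝ := (volume (ball (0 : (EuclideanSpace ℝ (Fin 3))) 1)).toReal with hV
  set n : ℕ := ⌈4 * N + 16 * N ^ 2 * C ^ 2 + 1⌉₊ with hn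
  refine ⟨(2 * N + 1) ^ n * (C ^ 2 * V), fun u hu t ht => ?_⟩
  have hC : 0 ≤ C := hu.nonneg
  have hV0 : 0 ≤ V := ENNReal.toReal_nonneg
  have hCV : 0 ≤ C ^ 2 * V := by positivity
  have h2N1 : (1 : ℝ) ≤ 2 * N + 1 := by linarith
  obtain ⟨p, hp, hNFp⟩ := hNF C u hu (-2) (by norm_num)
  have hLu : ∀ (s' t' : ℝ), -2 < s' → s' ≤ t' → t' < 0 → ∀ (F₀ B : ℝ), 0 ≤ B →
      (∀ z : (EuclideanSpace ℝ (Fin 3)), ∫ x in ball z 1, ‖u s' x‖ ^ 2 ≤ F₀) →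
      (∀ τ ∈ Icc s' t', ∀ z : (EuclideanSpace ℝ (Fin 3)), ∫ x in ball z 1, ‖u τ x‖ ^ 2 ≤ B) →
      ∀ x₀ : (EuclideanSpace ℝ (Fin 3)), ∫ x in ball x₀ 1, ‖u t' x‖ ^ 2 ≤
        N * F₀ + N * B * ((t' - s') + C * (Real.sqrt (-s') - Real.sqrt (-t'))) :=
    fun s' t' hs hst ht' F₀ B hB hF hBB x₀ =>
      hL C u hu (-2) p hp hNFp s' t' hs hst ht' F₀ B hB hF hBB x₀
  -- the number of steps
  have hn1 : (4 * N + 16 * N ^ 2 * C ^ 2 + 1 : ℝ) ≤ n := Nat.le_ceil _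
  have hNC2 : 0 ≤ 16 * N ^ 2 * C ^ 2 := by positivity
  have hnpos : (0 : ℝ) < n := by linarith
  have hn4N : 4 * N ≤ (n : ℝ) := by linarith
  have hn16 : 16 * N ^ 2 * C ^ 2 ≤ (n : ℝ) := by linarith
  -- the step
  set h : ℝ := (t + 1) / n with hh
  have ht1 : 0 < t + 1 := by linarith [ht.1]
  have hh0 : 0 < h := div_pos ht1 hnpos
  have hh1 : h ≤ 1 / n := div_le_div_of_nonneg_right (by linarith [ht.2]) hnpos.le
  have hNh : N * h ≤ 1 / 4 := by
    calc N * h ≤ N * (1 / n) := mul_le_mul_of_nonneg_left hh1 hN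
      _ = (4 * N) / n / 4 := by ring
      _ ≤ (n : ℝ) / n / 4 := by gcongr
      _ = 1 / 4 := by rw [div_self hnpos.ne']
  have hNCh : N * (C * Real.sqrt h) ≤ 1 / 4 := by
    have hsq : Real.sqrt h ≤ 1 / Real.sqrt n := by
      rw [← Real.sqrt_one, ← Real.sqrt_div zero_le_one] ; exact Real.sqrt_le_sqrt (by simpa using hh1)
    have hsn : 0 < Real.sqrt n := Real.sqrt_pos.2 hnpos
    have h4 : 4 * N * C ≤ Real.sqrt n := by
      have h0 : 0 ≤ 4 * N * C := by positivity
      rw [show 4 * N * C = Real.sqrt ((4 * N * C) ^ 2) by rw [Real.sqrt_sq h0]]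
      exact Real.sqrt_le_sqrt (by nlinarith)
    calc N * (C * Real.sqrt h) ≤ N * (C * (1 / Real.sqrt n)) := by gcongr
      _ = (4 * N * C) / Real.sqrt n / 4 := by ring
      _ ≤ Real.sqrt n / Real.sqrt n / 4 := by gcongr
      _ = 1 / 4 := by rw [div_self hsn.ne']
  -- the grid `tg i = -1 + i h`, `tg 0 = -1`, `tg n = t`
  set tg : ℕ → ℝ := fun i => -1 + i * h with htg
  have htg0 : tg 0 = -1 := by simp [htg]
  have htgn : tg n = t := by
    simp only [htg, hh]
    field_simp
    ring
  have htg_succ : ∀ i, tg (i + 1) = tg i + h := by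
    intro i; simp only [htg]; push_cast; ring
  have htg_ge : ∀ i, -1 ≤ tg i := fun i => by
    simp only [htg]; nlinarith [hh0.le, (Nat.cast_nonneg i : (0 : ℝ) ≤ i)]
  have htg_le : ∀ i, i ≤ n → tg i ≤ t := by
    intro i hi
    have : (i : ℝ) * h ≤ n * h := mul_le_mul_of_nonneg_right (Nat.cast_le.2 hi) hh0.le
    rw [← htgn]; simp only [htg]; linarith
  -- the ledger coefficient on one step is `≤ 1/2`
  have hμ : ∀ i, i + 1 ≤ n →
      N * ((tg (i + 1) - tg i) + C * (Real.sqrt (-tg i) - Real.sqrt (-tg (i + 1)))) ≤ 1 / 2 := by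
    intro i hi
    have e1 : tg (i + 1) - tg i = h := by rw [htg_succ]; ring
    have hneg : 0 ≤ -tg (i + 1) := by linarith [htg_le (i + 1) hi, ht.2]
    have hsq : Real.sqrt (-tg i) - Real.sqrt (-tg (i + 1)) ≤ Real.sqrt h := by
      have key := sqrt_sub_sqrt_le (x := -tg i) (y := -tg (i + 1)) hneg (by rw [htg_succ]; linarith)
      rwa [show -tg i - -tg (i + 1) = h by rw [htg_succ]; ring] at key
    calc N * ((tg (i + 1) - tg i) + C * (Real.sqrt (-tg i) - Real.sqrt (-tg (i + 1))))
        = N * h + N * (C * (Real.sqrt (-tg i) - Real.sqrt (-tg (i + 1)))) := by rw [e1]; ring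
      _ ≤ N * h + N * (C * Real.sqrt h) := by gcongr
      _ ≤ 1 / 4 + 1 / 4 := add_le_add hNh hNCh
      _ = 1 / 2 := by norm_num
  -- a priori (Type I) bound on `[-1, t]`
  have hB₀ : ∀ τ ∈ Icc (-1 : ℝ) t, ∀ z : (EuclideanSpace ℝ (Fin 3)), ∫ x in ball z 1, ‖u τ x‖ ^ 2 ≤ C ^ 2 / (-t) * V := by
    intro τ hτ z
    have hτ0 : τ < 0 := lt_of_le_of_lt hτ.2 ht.2
    refine (energy_unitBall_le_typeI hu hτ0 z).trans ?_
    refine mul_le_mul_of_nonneg_right ?_ hV0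
    exact div_le_div_of_nonneg_left (sq_nonneg C) (by linarith [ht.2]) (by linarith [hτ.2])
  -- induction over the grid
  have main : ∀ i : ℕ, i ≤ n → ∀ τ ∈ Icc (-1 : ℝ) (tg i), ∀ z : (EuclideanSpace ℝ (Fin 3)),
      ∫ x in ball z 1, ‖u τ x‖ ^ 2 ≤ (2 * N + 1) ^ i * (C ^ 2 * V) := by
    intro i
    induction i with
    | zero =>
      intro _ τ hτ z
      rw [htg0] at hτ
      have hτ1 : τ = -1 := le_antisymm hτ.2 hτ.1
      subst hτ1
      have key := energy_unitBall_le_typeI hu (τ := -1) (by norm_num) z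
      simp only [neg_neg, div_one, pow_zero, one_mul] at key ⊢
      exact key
    | succ i ih =>
      intro hi τ hτ z
      have hi' : i ≤ n := Nat.le_of_succ_le hi
      have ih' := ih hi'
      have hpow : (2 * N + 1) ^ i * (C ^ 2 * V) ≤ (2 * N + 1) ^ (i + 1) * (C ^ 2 * V) :=
        mul_le_mul_of_nonneg_right (pow_le_pow_right₀ h2N1 (Nat.le_succ i)) hCV
      rcases le_or_gt τ (tg i) with h1 | h1
      · exact (ih' τ ⟨hτ.1, h1⟩ z).trans hpow
      · have hab : tg i ≤ tg (i + 1) := by rw [htg_succ]; linarith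
        have ha : -2 < tg i := by linarith [htg_ge i]
        have hb : tg (i + 1) < 0 := lt_of_le_of_lt (htg_le (i + 1) hi) ht.2
        have hF : ∀ z : (EuclideanSpace ℝ (Fin 3)), ∫ x in ball z 1, ‖u (tg i) x‖ ^ 2 ≤ (2 * N + 1) ^ i * (C ^ 2 * V) :=
          fun z => ih' (tg i) ⟨htg_ge i, le_rfl⟩ z
        have hB₀' : ∀ τ' ∈ Icc (tg i) (tg (i + 1)), ∀ z : (EuclideanSpace ℝ (Fin 3)),
            ∫ x in ball z 1, ‖u τ' x‖ ^ 2 ≤ C ^ 2 / (-t) * V :=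
          fun τ' hτ' z => hB₀ τ' ⟨(htg_ge i).trans hτ'.1, hτ'.2.trans (htg_le (i + 1) hi)⟩ z
        have hstep := doubling_step hN hC hLu hab ha hb (hμ i hi) hB₀' hF τ ⟨h1.le, hτ.2⟩ z
        refine hstep.trans ?_
        calc 2 * N * ((2 * N + 1) ^ i * (C ^ 2 * V))
            ≤ (2 * N + 1) * ((2 * N + 1) ^ i * (C ^ 2 * V)) :=
              mul_le_mul_of_nonneg_right (by linarith) (by positivity)
          _ = (2 * N + 1) ^ (i + 1) * (C ^ 2 * V) := by ring
  exact main n le_rfl t ⟨by linarith [ht.1], by rw [htgn]⟩ 0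


/-- Registered form (sub-goal `fpl_closure_main` of crux stmt-NavierStokesRegularity-14060): the
doubling Grönwall closure of the unit-window ledger from the pressure block and the flux ledger,
with the near/far predicate abstract. -/
theorem fpl_closure_main :
    ∀ (NF : ℝ → ℝ → (ℝ → EuclideanSpace ℝ (Fin 3) → EuclideanSpace ℝ (Fin 3)) →
      (ℝ → EuclideanSpace ℝ (Fin 3) → ℝ) → ℝ → Prop) (c₀ N : ℝ), 0 ≤ N →
    (∀ (C : ℝ) (u : ℝ → EuclideanSpace ℝ (Fin 3) → EuclideanSpace ℝ (Fin 3)),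
      Literature.Analysis.FluidPDE.IsTypeIAncientMild C u → ∀ t₀ < (0 : ℝ),
      ∃ p : ℝ → EuclideanSpace ℝ (Fin 3) → ℝ,
        Literature.Analysis.FluidPDE.IsClassicalNSSolutionOn (Set.Ioo t₀ 0) 1 0 u p ∧ NF c₀ C u p t₀) →
    (∀ (C : ℝ) (u : ℝ → EuclideanSpace ℝ (Fin 3) → EuclideanSpace ℝ (Fin 3)),
      Literature.Analysis.FluidPDE.IsTypeIAncientMild C u → ∀ (t₀ : ℝ) (p : ℝ → EuclideanSpace ℝ (Fin 3) → ℝ),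
      Literature.Analysis.FluidPDE.IsClassicalNSSolutionOn (Set.Ioo t₀ 0) 1 0 u p → NF c₀ C u p t₀ →
      ∀ (s' t' : ℝ), t₀ < s' → s' ≤ t' → t' < 0 → ∀ (F₀ B : ℝ), 0 ≤ B →
      (∀ z : EuclideanSpace ℝ (Fin 3), ∫ x in Metric.ball z 1, ‖u s' x‖ ^ 2 ≤ F₀) →
      (∀ τ ∈ Set.Icc s' t', ∀ z : EuclideanSpace ℝ (Fin 3), ∫ x in Metric.ball z 1, ‖u τ x‖ ^ 2 ≤ B) →
      ∀ x₀ : EuclideanSpace ℝ (Fin 3), ∫ x in Metric.ball x₀ 1, ‖u t' x‖ ^ 2 ≤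
        N * F₀ + N * B * ((t' - s') + C * (Real.sqrt (-s') - Real.sqrt (-t')))) →
    ∀ C : ℝ, ∃ K : ℝ, ∀ (u : ℝ → EuclideanSpace ℝ (Fin 3) → EuclideanSpace ℝ (Fin 3)),
      Literature.Analysis.FluidPDE.IsTypeIAncientMild C u → ∀ t ∈ Set.Ioo (-1 : ℝ) 0,
      ∫ x in Metric.ball (0 : EuclideanSpace ℝ (Fin 3)) 1, ‖u t x‖ ^ 2 ≤ K :=
  fun _ _ _ hN hNF hL => unitWindow_of_ledger hN hNF hL

end Summit.NavierStokesRegularity.NavierStokesRegularity.Theorems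

end
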